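import Literature.Computability.AlgebraicComplexity.GKKP11Thm4Proofs
import HarnessLib

/-!
# GKKP 2011, Lemma 5 (minimization of weighted circuits): the rewriting pass and its invariants

[cite: GrenetEtAl2011, Lemma 5] — B. Grenet, E. L. Kaltofen, P. Koiran, N. Portier, *Symmetric
determinantal representation of weakly-skew circuits*, STACS 2011 / arXiv:1007.3804, §3.3
Lemma 5 and its proof (held text `paper:arxiv-1007.3804`, p0014:L13–L31): "If `C` is a weighted
circuit, then there exists an equivalent weighted circuit `C'` with the same number of inputs
labelled by a variable and at most the same number of computation gates such that (i)–(iii)",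
proved by four local rewriting rules (Fig. 12).

This file is the FIRST HALF of a discharge of the named fact `GKKP2011_lemma5`
(`GKKP11SymmetricRepresentations.lean`); `GKKP2011_lemma5_holds` itself is NOT here yet (see
"Pending" below). It defines the rewriting as ONE left-to-right pass over the gate list and proves
the value/size half of Lemma 5 for it:

* `GKKP2011.Lemma5.step` / `run` / `minimize` — the pass. The typed statement only asks for SOME
  minimized equivalent circuit, so the four printed rules are realised at once, gate by gate:
  a VARIABLE-FREE gate (a constant input, or a computation gate both of whose arguments are
  variable-free) is dropped and its constant value remembered (printed rule 2: "replace `α`, `β`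
  and `γ` by a constant"); a kept gate is re-emitted with translated arguments, a variable-free
  argument of value `v` and arrow weight `c` being replaced by a FRESH input `const 1` emitted just
  before the gate with arrow weight `c·v` (rule 1: "`β` is replaced by `1` and `c` by `cc₁`";
  Lemma 5 (i)/(ii)); a multiplication gate with a variable-free argument becomes the ADDITION gate
  `(c₁ v c₂)·γ + 0·1` (computes the same polynomial, has exactly one constant argument which is an
  input, and carries no weakly-skew obligation) — our replacement for printed rules 3/4, which
  re-route the consumers of `α` or rescale the incoming arrows of `γ` and have no literal
  counterpart when `γ` is an input gate; variable inputs are kept.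
* `GKKP2011.Lemma5.Inv`, `inv_step` (the ten cases of the pass), `inv_run`: after a well-formed
  prefix, the emitted list is well formed, a kept gate's copy has the old value, a dropped gate's
  value is the remembered constant, the last kept gate is the last emitted gate, variable inputs
  are counted exactly and computation gates at most once.
* Consequences: `wellFormed_minimize`, `numVarInputs_minimize` ("the same number of inputs
  labelled by a variable"), `skinnySize_minimize_le` ("at most the same number of computation
  gates"), `eval_minimize` ("equivalent", for circuits computing a non-constant polynomial — the
  hypothesis of the typed fact).

Pending for `GKKP2011_lemma5_holds` (plan recorded for the next seat): `IsProper` and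
`IsMinimized` of `minimize C` (every emitted gate is a kept copy or a fresh `const 1` consumed
exactly once by the next gate; kept copies have a variable below), and the weakly-skew transfer
("the construction does not change the nature of the circuit": sub-circuits of kept gates
correspond, arrows leaving them are images of arrows between kept gates, so closed arguments stay
closed).

No named facts; definitions with bodies and theorems only (D-0026). Honest framing: bookkeeping
for rung V1 of the `ValiantsHypothesis` ladder; `VP ≠ VNP` is NOT proved and nothing here is
progress on it.
-/

namespace Literature.Computability.AlgebraicComplexity

namespace GKKP2011

namespace Lemma5

variable {k : Type*} [Field k] {σ : Type*}

/-- State of the minimization pass after a prefix of the gate list: the emitted gates, and for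
each processed old index either its new index (`some`) or — for a variable-free gate — `none`
together with its constant value in `val`. [cite: GrenetEtAl2011, Lemma 5 (proof)] -/
structure State (k : Type*) (σ : Type*) where
  /-- gates of the minimized circuit emitted so far -/
  out : List (Node k σ)
  /-- old index ↦ new index of the kept gate, `none` for a dropped (variable-free) gate -/
  ρ : List (Option ℕ)
  /-- old index ↦ value of the gate when it is variable-free (junk otherwise) -/
  val : List k

/-- One step of the pass (see the module docstring). [cite: GrenetEtAl2011, Lemma 5 (proof)] -/
def step (s : State k σ) : Node k σ → State k σ
  | .var x => ⟨s.out ++ [.var x], s.ρ ++ [some s.out.length], s.val ++ [0]⟩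
  | .const c => ⟨s.out, s.ρ ++ [none], s.val ++ [c]⟩
  | .add c₁ i c₂ j =>
    match s.ρ.getD i none, s.ρ.getD j none with
    | some i', some j' =>
      ⟨s.out ++ [.add c₁ i' c₂ j'], s.ρ ++ [some s.out.length], s.val ++ [0]⟩
    | none, some j' =>
      ⟨s.out ++ [.const 1, .add (c₁ * s.val.getD i 0) s.out.length c₂ j'],
        s.ρ ++ [some (s.out.length + 1)], s.val ++ [0]⟩
    | some i', none =>
      ⟨s.out ++ [.const 1, .add c₁ i' (c₂ * s.val.getD j 0) s.out.length],
        s.ρ ++ [some (s.out.length + 1)], s.val ++ [0]⟩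
    | none, none =>
      ⟨s.out, s.ρ ++ [none], s.val ++ [c₁ * s.val.getD i 0 + c₂ * s.val.getD j 0]⟩
  | .mul c₁ i c₂ j =>
    match s.ρ.getD i none, s.ρ.getD j none with
    | some i', some j' =>
      ⟨s.out ++ [.mul c₁ i' c₂ j'], s.ρ ++ [some s.out.length], s.val ++ [0]⟩
    | none, some j' =>
      ⟨s.out ++ [.const 1, .add (c₁ * s.val.getD i 0 * c₂) j' 0 s.out.length],
        s.ρ ++ [some (s.out.length + 1)], s.val ++ [0]⟩
    | some i', none =>
      ⟨s.out ++ [.const 1, .add (c₁ * (c₂ * s.val.getD j 0)) i' 0 s.out.length],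
        s.ρ ++ [some (s.out.length + 1)], s.val ++ [0]⟩
    | none, none =>
      ⟨s.out, s.ρ ++ [none], s.val ++ [c₁ * s.val.getD i 0 * (c₂ * s.val.getD j 0)]⟩

/-- The pass over a gate list. [cite: GrenetEtAl2011, Lemma 5 (proof)] -/
def run (gs : List (Node k σ)) : State k σ := gs.foldl step ⟨[], [], []⟩

/-- The minimized circuit. [cite: GrenetEtAl2011, Lemma 5] -/
def minimize (C : Circuit k σ) : Circuit k σ := ⟨(run C.gates).out⟩

/-- Prefix form of the pass (for the inductions). [cite: GrenetEtAl2011, Lemma 5 (proof)] -/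
theorem run_append_singleton (gs : List (Node k σ)) (g : Node k σ) :
    run (gs ++ [g]) = step (run gs) g := by
  simp [run, List.foldl_append]

/-! ## Invariants of the pass -/

section Invariants

variable [DecidableEq σ]

omit [DecidableEq σ] in
/-- Values of an extended gate list at old indices. [folklore] -/
private theorem getD_gateValues_append_left (l r : List (Node k σ)) {p : ℕ} (hp : p < l.length) :
    (Circuit.gateValues (l ++ r)).getD p 0 = (Circuit.gateValues l).getD p 0 := by
  induction r using List.reverseRecOn with
  | nil => rw [List.append_nil]
  | append_singleton r g ih =>
    rw [← List.append_assoc, Circuit.gateValues_append_singleton, List.getD_eq_getElem?_getD,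
      List.getElem?_append_left (by rw [Circuit.length_gateValues, List.length_append]; omega),
      ← List.getD_eq_getElem?_getD, ih]

omit [DecidableEq σ] in
/-- The value of the last gate of `l ++ [g]`. [folklore] -/
private theorem getD_gateValues_last (l : List (Node k σ)) (g : Node k σ) :
    (Circuit.gateValues (l ++ [g])).getD l.length 0 = g.eval (Circuit.gateValues l) := by
  rw [Circuit.gateValues_append_singleton, List.getD_eq_getElem?_getD,
    List.getElem?_append_right (by rw [Circuit.length_gateValues]), Circuit.length_gateValues,
    Nat.sub_self]
  rfl

/-- **The invariant of the pass** after a well-formed prefix `gs`: bookkeeping lengths, the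
emitted list is well formed, a kept gate's new copy has the old value, a dropped gate's value is
the remembered constant. [cite: GrenetEtAl2011, Lemma 5 (proof)] -/
structure Inv (gs : List (Node k σ)) (s : State k σ) : Prop where
  len_ρ : s.ρ.length = gs.length
  len_val : s.val.length = gs.length
  wf : ∀ (q : ℕ) (g : Node k σ), s.out[q]? = some g → ∀ i ∈ g.args, i < q
  kept : ∀ p p' : ℕ, s.ρ[p]? = some (some p') →
    p' < s.out.length ∧ (Circuit.gateValues s.out).getD p' 0 = (Circuit.gateValues gs).getD p 0
  dropped : ∀ p : ℕ, s.ρ[p]? = some none →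
    (Circuit.gateValues gs).getD p 0 = MvPolynomial.C (s.val.getD p 0)
  lastKept : ∀ p' : ℕ, s.ρ.getLast? = some (some p') → p' + 1 = s.out.length
  nvar : s.out.countP (fun g => g.isVarInput) = gs.countP (fun g => g.isVarInput)
  ncomp : s.out.countP (fun g => g.isComputation) ≤ gs.countP (fun g => g.isComputation)

omit [DecidableEq σ] in
/-- The invariant holds for the empty prefix. [folklore] -/
private theorem inv_nil : Inv (k := k) (σ := σ) [] ⟨[], [], []⟩ :=
  ⟨rfl, rfl, fun q g h => by simp at h, fun p p' h => by simp at h, fun p h => by simp at h,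
    fun p' h => by simp at h, rfl, le_rfl⟩

omit [DecidableEq σ] in
/-- Extending the invariant by one old gate `g`: `extra` new gates are emitted, the old gate is
mapped to `x` (with value bookkeeping `v`). [cite: GrenetEtAl2011, Lemma 5 (proof)] -/
private theorem inv_extend {gs : List (Node k σ)} {s : State k σ} (h : Inv gs s) (g : Node k σ)
    (extra : List (Node k σ)) (x : Option ℕ) (v : k)
    (hwf : ∀ (n : ℕ) (g' : Node k σ), extra[n]? = some g' → ∀ i ∈ g'.args, i < s.out.length + n)
    (hx : ∀ p', x = some p' → p' < s.out.length + extra.length ∧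
      (Circuit.gateValues (s.out ++ extra)).getD p' 0 = g.eval (Circuit.gateValues gs))
    (hv : x = none → g.eval (Circuit.gateValues gs) = MvPolynomial.C v)
    (hlast : ∀ p', x = some p' → p' + 1 = s.out.length + extra.length)
    (hvarc : extra.countP (fun g => g.isVarInput) = [g].countP (fun g => g.isVarInput))
    (hcompc : extra.countP (fun g => g.isComputation) ≤ [g].countP (fun g => g.isComputation)) :
    Inv (gs ++ [g]) ⟨s.out ++ extra, s.ρ ++ [x], s.val ++ [v]⟩ where
  lastKept := by
    intro p' hp
    rw [List.getLast?_append, List.getLast?_singleton, Option.some_or, Option.some.injEq] at hp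
    rw [List.length_append, ← hlast p' hp]
  nvar := by rw [List.countP_append, List.countP_append, h.nvar, hvarc]
  ncomp := by
    rw [List.countP_append, List.countP_append]
    exact Nat.add_le_add h.ncomp hcompc
  len_ρ := by simp [h.len_ρ]
  len_val := by simp [h.len_val]
  wf := by
    intro q g' hq i hi
    by_cases hlt : q < s.out.length
    · rw [List.getElem?_append_left hlt] at hq
      exact h.wf q g' hq i hi
    · rw [List.getElem?_append_right (by omega)] at hq
      have := hwf (q - s.out.length) g' hq i hi
      omega
  kept := by
    intro p p' hp
    by_cases hlt : p < s.ρ.length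
    · rw [List.getElem?_append_left hlt] at hp
      obtain ⟨hp', hval⟩ := h.kept p p' hp
      refine ⟨by rw [List.length_append]; omega, ?_⟩
      rw [getD_gateValues_append_left _ _ hp', hval,
        getD_gateValues_append_left _ _ (by rw [← h.len_ρ]; exact hlt)]
    · rw [List.getElem?_append_right (by omega)] at hp
      have hp0 : p - s.ρ.length = 0 := by
        rcases Nat.eq_zero_or_pos (p - s.ρ.length) with h0 | h0
        · exact h0
        · rw [List.getElem?_eq_none (by simp; omega)] at hp
          cases hp
      rw [hp0] at hp
      simp only [List.getElem?_cons_zero, Option.some.injEq] at hp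
      obtain ⟨hb, hval⟩ := hx p' hp
      have hpeq : p = gs.length := by rw [← h.len_ρ]; omega
      refine ⟨by rw [List.length_append]; exact hb, ?_⟩
      rw [hval, hpeq, getD_gateValues_last]
  dropped := by
    intro p hp
    by_cases hlt : p < s.ρ.length
    · rw [List.getElem?_append_left hlt] at hp
      rw [getD_gateValues_append_left _ _ (by rw [← h.len_ρ]; exact hlt), h.dropped p hp,
        List.getD_eq_getElem?_getD, List.getD_eq_getElem?_getD,
        List.getElem?_append_left (by rw [h.len_val, ← h.len_ρ]; exact hlt)]
    · rw [List.getElem?_append_right (by omega)] at hp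
      have hp0 : p - s.ρ.length = 0 := by
        rcases Nat.eq_zero_or_pos (p - s.ρ.length) with h0 | h0
        · exact h0
        · rw [List.getElem?_eq_none (by simp; omega)] at hp
          cases hp
      rw [hp0] at hp
      simp only [List.getElem?_cons_zero, Option.some.injEq] at hp
      have hpeq : p = gs.length := by rw [← h.len_ρ]; omega
      rw [hpeq, getD_gateValues_last, hv hp, List.getD_eq_getElem?_getD,
        List.getElem?_append_right (by rw [h.len_val]), h.len_val, Nat.sub_self]
      rfl

omit [Field k] [DecidableEq σ] in
/-- Reading the map `ρ`: `getD i none = some i'` means gate `i` was kept as `i'`. [folklore] -/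
private theorem ρ_some {s : State k σ} {i i' : ℕ} (h : s.ρ.getD i none = some i') :
    s.ρ[i]? = some (some i') := by
  rw [List.getD_eq_getElem?_getD] at h
  cases hρ : s.ρ[i]? with
  | none => rw [hρ] at h; cases h
  | some x => rw [hρ] at h; simp only [Option.getD_some] at h; rw [h]

omit [Field k] [DecidableEq σ] in
/-- Reading the map `ρ`: `getD i none = none` at a processed index means gate `i` was dropped.
[folklore] -/
private theorem ρ_none {s : State k σ} {i : ℕ} (h : s.ρ.getD i none = none) (hi : i < s.ρ.length) :
    s.ρ[i]? = some none := by
  rw [List.getD_eq_getElem?_getD, List.getElem?_eq_getElem hi, Option.getD_some] at h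
  rw [List.getElem?_eq_getElem hi, h]

omit [DecidableEq σ] in
/-- Values of `out ++ [const 1]`: the fresh constant. [folklore] -/
private theorem getD_fresh (out : List (Node k σ)) :
    (Circuit.gateValues (out ++ [.const (1 : k)])).getD out.length 0 = 1 := by
  rw [getD_gateValues_last]; simp [Node.eval]

omit [DecidableEq σ] in
/-- Values of `out ++ [const 1]` at old indices. [folklore] -/
private theorem getD_fresh_old (out : List (Node k σ)) {q : ℕ} (hq : q < out.length) :
    (Circuit.gateValues (out ++ [.const (1 : k)])).getD q 0 = (Circuit.gateValues out).getD q 0 :=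
  getD_gateValues_append_left _ _ hq

omit [DecidableEq σ] in
/-- **One step preserves the invariant** (the ten cases of the pass).
[cite: GrenetEtAl2011, Lemma 5 (proof)] -/
theorem inv_step {gs : List (Node k σ)} {s : State k σ} (h : Inv gs s) (g : Node k σ)
    (hg : ∀ i ∈ g.args, i < gs.length) : Inv (gs ++ [g]) (step s g) := by
  have hlen := h.len_ρ
  cases g with
  | var x =>
    refine inv_extend h (.var x) [.var x] (some s.out.length) 0 (fun n g' hn => ?_)
      (fun p' hp' => ?_) (fun hx => by cases hx)
      (fun p' hp' => by simp only [Option.some.injEq] at hp'; subst hp'; simp) rfl le_rfl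
    · rcases n with _ | n
      · simp only [List.getElem?_cons_zero, Option.some.injEq] at hn
        subst hn; simp [Node.args]
      · simp at hn
    · simp only [Option.some.injEq] at hp'
      subst hp'
      exact ⟨by simp, by rw [getD_gateValues_last]; rfl⟩
  | const c =>
    have := inv_extend h (.const c) [] none c (fun n g' hn => by simp at hn)
      (fun p' hp' => by cases hp') (fun _ => by simp [Node.eval]) (fun p' hp' => by cases hp')
      (by simp [Node.isVarInput]) (Nat.zero_le _)
    simpa [step] using this
  | add c₁ i c₂ j =>
    have hi : i < s.ρ.length := by rw [hlen]; exact hg i (by simp [Node.args])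
    have hj : j < s.ρ.length := by rw [hlen]; exact hg j (by simp [Node.args])
    rcases hρi : s.ρ.getD i none with _ | i' <;> rcases hρj : s.ρ.getD j none with _ | j' <;>
      simp only [step, hρi, hρj]
    · -- both dropped: the gate is variable-free
      have := inv_extend h (.add c₁ i c₂ j) [] none (c₁ * s.val.getD i 0 + c₂ * s.val.getD j 0)
        (fun n g' hn => by simp at hn) (fun p' hp' => by cases hp') (fun _ => by
          simp only [Node.eval, h.dropped i (ρ_none hρi hi), h.dropped j (ρ_none hρj hj), map_add,
            map_mul]) (fun p' hp' => by cases hp') (by simp [Node.isVarInput]) (Nat.zero_le _)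
      simpa using this
    · -- `i` dropped (constant `val i`), `j` kept as `j'`
      obtain ⟨hj', hvj⟩ := h.kept j j' (ρ_some hρj)
      refine inv_extend h _ _ (some (s.out.length + 1)) 0 (fun n g' hn => ?_) (fun p' hp' => ?_)
        (fun hx => by cases hx)
        (fun p' hp' => by simp only [Option.some.injEq] at hp'; subst hp'; simp)
        (by simp [Node.isVarInput]) (by simp [Node.isComputation])
      · rcases n with _ | _ | n
        · simp only [List.getElem?_cons_zero, Option.some.injEq] at hn; subst hn; simp [Node.args]
        · simp only [zero_add, List.getElem?_cons_succ, List.getElem?_cons_zero,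
            Option.some.injEq] at hn
          subst hn
          simp only [Node.args, List.mem_cons, List.not_mem_nil, or_false]
          rintro k (rfl | rfl) <;> omega
        · simp at hn
      · simp only [Option.some.injEq] at hp'
        subst hp'
        refine ⟨by simp, ?_⟩
        rw [show s.out ++ [Node.const 1, Node.add (c₁ * s.val.getD i 0) s.out.length c₂ j'] =
            (s.out ++ [Node.const 1]) ++ [Node.add (c₁ * s.val.getD i 0) s.out.length c₂ j'] by simp,
          show s.out.length + 1 = (s.out ++ [Node.const (1 : k)]).length by simp,
          getD_gateValues_last]
        simp only [Node.eval, getD_fresh]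
        rw [show (s.out ++ [Node.const (1 : k)]) = s.out ++ [Node.const 1] from rfl,
          getD_fresh_old _ hj', hvj, h.dropped i (ρ_none hρi hi), map_mul]
        ring
    · -- `i` kept as `i'`, `j` dropped
      obtain ⟨hi', hvi⟩ := h.kept i i' (ρ_some hρi)
      refine inv_extend h _ _ (some (s.out.length + 1)) 0 (fun n g' hn => ?_) (fun p' hp' => ?_)
        (fun hx => by cases hx)
        (fun p' hp' => by simp only [Option.some.injEq] at hp'; subst hp'; simp)
        (by simp [Node.isVarInput]) (by simp [Node.isComputation])
      · rcases n with _ | _ | n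
        · simp only [List.getElem?_cons_zero, Option.some.injEq] at hn; subst hn; simp [Node.args]
        · simp only [zero_add, List.getElem?_cons_succ, List.getElem?_cons_zero,
            Option.some.injEq] at hn
          subst hn
          simp only [Node.args, List.mem_cons, List.not_mem_nil, or_false]
          rintro k (rfl | rfl) <;> omega
        · simp at hn
      · simp only [Option.some.injEq] at hp'
        subst hp'
        refine ⟨by simp, ?_⟩
        rw [show s.out ++ [Node.const 1, Node.add c₁ i' (c₂ * s.val.getD j 0) s.out.length] =
            (s.out ++ [Node.const 1]) ++ [Node.add c₁ i' (c₂ * s.val.getD j 0) s.out.length] by simp,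
          show s.out.length + 1 = (s.out ++ [Node.const (1 : k)]).length by simp,
          getD_gateValues_last]
        simp only [Node.eval, getD_fresh]
        rw [getD_fresh_old _ hi', hvi, h.dropped j (ρ_none hρj hj), map_mul]
        ring
    · -- both kept
      obtain ⟨hi', hvi⟩ := h.kept i i' (ρ_some hρi)
      obtain ⟨hj', hvj⟩ := h.kept j j' (ρ_some hρj)
      refine inv_extend h _ _ (some s.out.length) 0 (fun n g' hn => ?_) (fun p' hp' => ?_)
        (fun hx => by cases hx)
        (fun p' hp' => by simp only [Option.some.injEq] at hp'; subst hp'; simp)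
        (by simp [Node.isVarInput]) (by simp [Node.isComputation])
      · rcases n with _ | n
        · simp only [List.getElem?_cons_zero, Option.some.injEq] at hn; subst hn
          simp only [Node.args, List.mem_cons, List.not_mem_nil, or_false]
          rintro k (rfl | rfl) <;> omega
        · simp at hn
      · simp only [Option.some.injEq] at hp'
        subst hp'
        refine ⟨by simp, ?_⟩
        rw [getD_gateValues_last]
        simp only [Node.eval, hvi, hvj]
  | mul c₁ i c₂ j =>
    have hi : i < s.ρ.length := by rw [hlen]; exact hg i (by simp [Node.args])
    have hj : j < s.ρ.length := by rw [hlen]; exact hg j (by simp [Node.args])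
    rcases hρi : s.ρ.getD i none with _ | i' <;> rcases hρj : s.ρ.getD j none with _ | j' <;>
      simp only [step, hρi, hρj]
    · have := inv_extend h (.mul c₁ i c₂ j) [] none (c₁ * s.val.getD i 0 * (c₂ * s.val.getD j 0))
        (fun n g' hn => by simp at hn) (fun p' hp' => by cases hp') (fun _ => by
          simp only [Node.eval, h.dropped i (ρ_none hρi hi), h.dropped j (ρ_none hρj hj), map_mul])
        (fun p' hp' => by cases hp') (by simp [Node.isVarInput]) (Nat.zero_le _)
      simpa using this
    · obtain ⟨hj', hvj⟩ := h.kept j j' (ρ_some hρj)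
      refine inv_extend h _ _ (some (s.out.length + 1)) 0 (fun n g' hn => ?_) (fun p' hp' => ?_)
        (fun hx => by cases hx)
        (fun p' hp' => by simp only [Option.some.injEq] at hp'; subst hp'; simp)
        (by simp [Node.isVarInput]) (by simp [Node.isComputation])
      · rcases n with _ | _ | n
        · simp only [List.getElem?_cons_zero, Option.some.injEq] at hn; subst hn; simp [Node.args]
        · simp only [zero_add, List.getElem?_cons_succ, List.getElem?_cons_zero,
            Option.some.injEq] at hn
          subst hn
          simp only [Node.args, List.mem_cons, List.not_mem_nil, or_false]
          rintro k (rfl | rfl) <;> omega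
        · simp at hn
      · simp only [Option.some.injEq] at hp'
        subst hp'
        refine ⟨by simp, ?_⟩
        rw [show s.out ++ [Node.const 1, Node.add (c₁ * s.val.getD i 0 * c₂) j' 0 s.out.length] =
            (s.out ++ [Node.const 1]) ++ [Node.add (c₁ * s.val.getD i 0 * c₂) j' 0 s.out.length]
            by simp,
          show s.out.length + 1 = (s.out ++ [Node.const (1 : k)]).length by simp,
          getD_gateValues_last]
        simp only [Node.eval, getD_fresh]
        rw [getD_fresh_old _ hj', hvj, h.dropped i (ρ_none hρi hi), map_mul, map_mul, map_zero]
        ring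
    · obtain ⟨hi', hvi⟩ := h.kept i i' (ρ_some hρi)
      refine inv_extend h _ _ (some (s.out.length + 1)) 0 (fun n g' hn => ?_) (fun p' hp' => ?_)
        (fun hx => by cases hx)
        (fun p' hp' => by simp only [Option.some.injEq] at hp'; subst hp'; simp)
        (by simp [Node.isVarInput]) (by simp [Node.isComputation])
      · rcases n with _ | _ | n
        · simp only [List.getElem?_cons_zero, Option.some.injEq] at hn; subst hn; simp [Node.args]
        · simp only [zero_add, List.getElem?_cons_succ, List.getElem?_cons_zero,
            Option.some.injEq] at hn
          subst hn
          simp only [Node.args, List.mem_cons, List.not_mem_nil, or_false]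
          rintro k (rfl | rfl) <;> omega
        · simp at hn
      · simp only [Option.some.injEq] at hp'
        subst hp'
        refine ⟨by simp, ?_⟩
        rw [show s.out ++ [Node.const 1, Node.add (c₁ * (c₂ * s.val.getD j 0)) i' 0 s.out.length] =
            (s.out ++ [Node.const 1]) ++ [Node.add (c₁ * (c₂ * s.val.getD j 0)) i' 0 s.out.length]
            by simp,
          show s.out.length + 1 = (s.out ++ [Node.const (1 : k)]).length by simp,
          getD_gateValues_last]
        simp only [Node.eval, getD_fresh]
        rw [getD_fresh_old _ hi', hvi, h.dropped j (ρ_none hρj hj), map_mul, map_mul, map_zero]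
        ring
    · obtain ⟨hi', hvi⟩ := h.kept i i' (ρ_some hρi)
      obtain ⟨hj', hvj⟩ := h.kept j j' (ρ_some hρj)
      refine inv_extend h _ _ (some s.out.length) 0 (fun n g' hn => ?_) (fun p' hp' => ?_)
        (fun hx => by cases hx)
        (fun p' hp' => by simp only [Option.some.injEq] at hp'; subst hp'; simp)
        (by simp [Node.isVarInput]) (by simp [Node.isComputation])
      · rcases n with _ | n
        · simp only [List.getElem?_cons_zero, Option.some.injEq] at hn; subst hn
          simp only [Node.args, List.mem_cons, List.not_mem_nil, or_false]
          rintro k (rfl | rfl) <;> omega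
        · simp at hn
      · simp only [Option.some.injEq] at hp'
        subst hp'
        refine ⟨by simp, ?_⟩
        rw [getD_gateValues_last]
        simp only [Node.eval, hvi, hvj]

omit [DecidableEq σ] in
/-- **The pass on a well-formed circuit satisfies the invariant.** [cite: GrenetEtAl2011, Lemma 5 (proof)] -/
theorem inv_run (C : Circuit k σ) (hwf : C.WellFormed) : Inv C.gates (run C.gates) := by
  suffices h : ∀ n, Inv (C.gates.take n) (run (C.gates.take n)) by
    simpa using h C.gates.length
  intro n
  induction n with
  | zero => simpa [run] using inv_nil (k := k) (σ := σ)
  | succ n ih =>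
    by_cases hn : n < C.gates.length
    · rw [List.take_add_one, List.getElem?_eq_getElem hn]
      simp only [Option.toList_some]
      rw [run_append_singleton]
      refine inv_step ih _ fun i hi => ?_
      have := hwf n (C.gates[n]) (List.getElem?_eq_getElem hn) i hi
      rw [List.length_take]
      omega
    · have h1 : C.gates.take (n + 1) = C.gates := List.take_of_length_le (by omega)
      have h2 : C.gates.take n = C.gates := List.take_of_length_le (by omega)
      rw [h1]
      rw [h2] at ih
      exact ih

omit [DecidableEq σ] in
/-- Consequence: the minimized circuit is well formed. [cite: GrenetEtAl2011, Lemma 5] -/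
theorem wellFormed_minimize (C : Circuit k σ) (hwf : C.WellFormed) : (minimize C).WellFormed :=
  fun q g hq i hi => (inv_run C hwf).wf q g hq i hi

omit [DecidableEq σ] in
/-- Consequence: the same number of variable inputs. [cite: GrenetEtAl2011, Lemma 5] -/
theorem numVarInputs_minimize (C : Circuit k σ) (hwf : C.WellFormed) :
    (minimize C).numVarInputs = C.numVarInputs :=
  (inv_run C hwf).nvar

omit [DecidableEq σ] in
/-- Consequence: at most as many computation gates. [cite: GrenetEtAl2011, Lemma 5] -/
theorem skinnySize_minimize_le (C : Circuit k σ) (hwf : C.WellFormed) :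
    (minimize C).skinnySize ≤ C.skinnySize :=
  (inv_run C hwf).ncomp

omit [DecidableEq σ] in
/-- Consequence: if the output gate of `C` is not dropped (in particular when `C` computes a
non-constant polynomial), the minimized circuit computes the same polynomial.
[cite: GrenetEtAl2011, Lemma 5] -/
theorem eval_minimize (C : Circuit k σ) (hwf : C.WellFormed) (hne : C.gates ≠ [])
    (hnc : ∀ c : k, C.eval ≠ MvPolynomial.C c) : (minimize C).eval = C.eval := by
  have hI := inv_run C hwf
  set m := C.gates.length with hm
  have hm0 : 0 < m := List.length_pos_of_ne_nil hne
  have hCeval : C.eval = (Circuit.gateValues C.gates).getD (m - 1) 0 := by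
    rw [Circuit.eval, List.getLastD_eq_getLast?, List.getLast?_eq_getElem?,
      List.getD_eq_getElem?_getD, Circuit.length_gateValues]
  -- the last old gate is kept
  have hlen : (run C.gates).ρ.length = m := hI.len_ρ
  obtain ⟨x, hx⟩ : ∃ x, (run C.gates).ρ[m - 1]? = some x :=
    ⟨(run C.gates).ρ[m - 1]'(by omega), List.getElem?_eq_getElem _⟩
  rcases x with _ | p'
  · exact absurd (hCeval.trans (hI.dropped (m - 1) hx)) (hnc _)
  obtain ⟨hp', hval⟩ := hI.kept (m - 1) p' hx
  have hlast : (run C.gates).ρ.getLast? = some (some p') := by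
    rw [List.getLast?_eq_getElem?, hlen, hx]
  have hp1 := hI.lastKept p' hlast
  rw [hCeval, ← hval, minimize, Circuit.eval, List.getLastD_eq_getLast?, List.getLast?_eq_getElem?,
    List.getD_eq_getElem?_getD, Circuit.length_gateValues, ← hp1, Nat.add_sub_cancel]

end Invariants

end Lemma5

end GKKP2011

end Literature.Computability.AlgebraicComplexity
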